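import Summits.RiemannHypothesis.RiemannHypothesis.Theses.SpectralTrace

/-!
# Sketch (crux-ideate, ideator 2, round 1) — crux `WindowTracePrime2` (stmt-RiemannHypothesis-11196)

First lemmas of the two idea cards `pick-slope` and `anchor-float`, stated over existing
declarations only (no new definitions, no sorry).  They are `def … : Prop` signatures; nothing is
proved here.  `lean check` rc 0 is the only claim.

Notation: `ĥ(1/2 + it) = weilMellin h (1/2 + t I)` is the Fourier transform of `h`;
`Q(h) = weilQuadratic h = W(h ⋆ h̃)`; the crux is `Trace(log 3)`.
-/

namespace Summit.RiemannHypothesis.RiemannHypothesis.Cruxes.WindowTracePrime2.Ideator2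

open Literature.NumberTheory.LFunctions MeasureTheory Set Complex
open scoped ContDiff

/-- The window-trace property at level `A` for a real family (the crux is `∃ ι γ, Trace (log 3) ι γ`). -/
def Trace (A : ℝ) (ι : Type) (γ : ι → ℝ) : Prop :=
  ∀ g : ℝ → ℂ, IsWeilTest g → tsupport g ⊆ Icc (-A) A →
    HasSum (fun i => weilMellin g (1 / 2 + (γ i : ℂ) * I)) (weilFunctional g)

/-- Sanity: the crux is literally `∃ ι γ, Trace (log 3) ι γ`. -/
example : Theses.SpectralTrace.WindowTracePrime2 ↔ ∃ (ι : Type) (γ : ι → ℝ), Trace (Real.log 3) ι γ :=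
  Iff.rfl

/-! ## Card `pick-slope` — first lemma: the Weil–Christoffel necessary condition

`Λ_L(t) := inf { Re Q(h) : h test, supp h ⊆ [-L/2, L/2], ĥ(1/2+it) = 1 }` is the reciprocal of the
reproducing-kernel diagonal `K_L(t,t)` of the window space; every atom of every witness has
`1 ≤ multiplicity ≤ Λ_L(atom)` (maximal-mass principle of M. Riesz / Akhiezer, here one line from
`HasSum` of non-negative reals).  PROVABLE NOW: `k = h ⋆ h̃` is a Weil test supported in
`[-log 3, log 3]` (`IsWeilTest.weilConv`, `IsWeilTest.weilReflect`,
`tsupport_weilConv_weilReflect_subset`), `k̂(1/2+iγ) = |ĥ(1/2+iγ)|²`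
(`weilMellin_weilConv_holds`, `weilMellin_weilReflect_holds`), and a `HasSum` of non-negative reals
dominates each term. -/
def ChristoffelNecessary : Prop :=
  ∀ (ι : Type) (γ : ι → ℝ), Trace (Real.log 3) ι γ →
    ∀ (i : ι) (h : ℝ → ℂ), IsWeilTest h →
      tsupport h ⊆ Icc (-(Real.log 3 / 2)) (Real.log 3 / 2) →
      weilMellin h (1 / 2 + (γ i : ℂ) * I) = 1 →
      1 ≤ (weilQuadratic h).re

/-- Same principle with multiplicity: the whole fibre of `γ` over the value `γ i` is paid for by
`Q(h)` (so `Λ_L(t) < 2` forces simple atoms, `Λ_L(t) < 1` forbids atoms at `t`). -/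
def ChristoffelFibreBound : Prop :=
  ∀ (ι : Type) (γ : ι → ℝ), Trace (Real.log 3) ι γ →
    ∀ (i : ι) (h : ℝ → ℂ), IsWeilTest h →
      tsupport h ⊆ Icc (-(Real.log 3 / 2)) (Real.log 3 / 2) →
      weilMellin h (1 / 2 + (γ i : ℂ) * I) = 1 →
      ∀ s : Finset ι, (∀ j ∈ s, γ j = γ i) → (s.card : ℝ) ≤ (weilQuadratic h).re


/-- EXTREMAL RIGIDITY (germ of the maximal-mass / orthogonal-solution theory; PROVABLE NOW from
`WindowTraceArch.Disproof.hasSum_norm_sq_of_windowTrace` at `A = log 3`): if a half-window test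
`h` with `ĥ(1/2+iγ_i) = 1` realises the Christoffel bound with equality, `Re Q(h) = 1`, then `ĥ`
vanishes at every other atom VALUE of the witness (a `HasSum` of non-negative reals equal to one of
its terms has all other terms zero).  With the Weyl law for witnesses (Disproof (N), deferred) this
gives the STRICT inequality `Λ_L > 1` on the range of `γ`: an entire function of exponential type
`(log 3)/2` cannot vanish on a set of counting function `(T/2π) log T`. -/
def ChristoffelExtremalRigidity : Prop :=
  ∀ (ι : Type) (γ : ι → ℝ), Trace (Real.log 3) ι γ →
    ∀ (i : ι) (h : ℝ → ℂ), IsWeilTest h →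
      tsupport h ⊆ Icc (-(Real.log 3 / 2)) (Real.log 3 / 2) →
      weilMellin h (1 / 2 + (γ i : ℂ) * I) = 1 → (weilQuadratic h).re = 1 →
      ∀ j : ι, γ j ≠ γ i → weilMellin h (1 / 2 + (γ j : ℂ) * I) = 0

/-! ## Card `anchor-float` — glue and first analytic stub

ANCHOR: finitely many real atoms `γ₀ : Fin m → ℝ` (in the line: the zeta ordinates certified on the
critical line up to a height `H`), FLOAT: a real family `γ₁` realising the residual functional
`g ↦ W(g) − Σ_j ĝ(γ₀ j)` on the window.  The union is a witness (pure bookkeeping: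
`HasSum` on `Fin m ⊕ κ`). -/
def AnchoredSplit : Prop :=
  ∀ (m : ℕ) (γ₀ : Fin m → ℝ) (κ : Type) (γ₁ : κ → ℝ),
    (∀ g : ℝ → ℂ, IsWeilTest g → tsupport g ⊆ Icc (-Real.log 3) (Real.log 3) →
      HasSum (fun i => weilMellin g (1 / 2 + (γ₁ i : ℂ) * I))
        (weilFunctional g - ∑ j, weilMellin g (1 / 2 + (γ₀ j : ℂ) * I))) →
    Theses.SpectralTrace.WindowTracePrime2

/-- FLOAT, first analytic stub (exact Poisson bookkeeping for a super-Nyquist half-chirp; see the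
card, "Poisson–Abel–Plana calculus"): if `φ` is smooth on `ℝ`, vanishes at the starting height `H`,
has slope at least the Nyquist rate `log 3 / 2π` plus a margin beyond `H`, and obeys symbol bounds,
then the half-chirp `γ n := φ⁻¹(n)` (`n : ℕ`) reproduces, on every Weil test supported in the
window, its density term `∫_{t>H} ĝ(1/2+it) φ'(t) dt` up to a functional `g ↦ ∫ g·A` with a SMOOTH
kernel `A` depending only on `φ` and `H` (no stationary Poisson alias for `|u| ≤ log 3`; one edge at
`H`).  Unproved; classical non-stationary phase + Euler–Maclaurin. -/
def SuperNyquistHalfChirp : Prop :=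
  ∀ (φ : ℝ → ℝ) (H δ : ℝ) (γ : ℕ → ℝ), 1 ≤ H → 0 < δ → ContDiff ℝ ∞ φ → φ H = 0 →
    (∀ t, H ≤ t → Real.log 3 / (2 * Real.pi) + δ ≤ deriv φ t) →
    (∀ j : ℕ, 1 ≤ j → ∃ C : ℝ, ∀ t, H ≤ t →
        |iteratedDeriv j φ t| ≤ C * t ^ (1 - (j : ℝ)) * Real.log (t + 2)) →
    (∀ n, H ≤ γ n ∧ φ (γ n) = n) →
    ∃ A : ℝ → ℂ, ContDiff ℝ ∞ A ∧
      ∀ g : ℝ → ℂ, IsWeilTest g → tsupport g ⊆ Icc (-Real.log 3) (Real.log 3) →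
        HasSum (fun n => weilMellin g (1 / 2 + (γ n : ℂ) * I))
          ((∫ t in Ioi H, weilMellin g (1 / 2 + (t : ℂ) * I) * ((deriv φ t : ℝ) : ℂ)) + ∫ u, g u * A u)

/-- FLOAT, symmetric version actually used (atoms `±γ n`), same conclusion shape. -/
def SuperNyquistHalfChirpSymm : Prop :=
  ∀ (φ : ℝ → ℝ) (H δ : ℝ) (γ : ℕ → ℝ), 1 ≤ H → 0 < δ → ContDiff ℝ ∞ φ → φ H = 0 →
    (∀ t, H ≤ t → Real.log 3 / (2 * Real.pi) + δ ≤ deriv φ t) →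
    (∀ j : ℕ, 1 ≤ j → ∃ C : ℝ, ∀ t, H ≤ t →
        |iteratedDeriv j φ t| ≤ C * t ^ (1 - (j : ℝ)) * Real.log (t + 2)) →
    (∀ n, H ≤ γ n ∧ φ (γ n) = n) →
    ∃ A : ℝ → ℂ, ContDiff ℝ ∞ A ∧
      ∀ g : ℝ → ℂ, IsWeilTest g → tsupport g ⊆ Icc (-Real.log 3) (Real.log 3) →
        HasSum (fun p : ℕ ⊕ ℕ => weilMellin g (1 / 2 + ((Sum.elim γ (fun n => -γ n) p : ℝ) : ℂ) * I))
          ((∫ t in Ioi H, (weilMellin g (1 / 2 + (t : ℂ) * I) + weilMellin g (1 / 2 - (t : ℂ) * I))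
              * ((deriv φ t : ℝ) : ℂ)) + ∫ u, g u * A u)

end Summit.RiemannHypothesis.RiemannHypothesis.Cruxes.WindowTracePrime2.Ideator2
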